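import Summits.Ventures.CertifiedManyBodySolver.Observables.RungLeavesStiffnessAnchor
import Summits.Ventures.CertifiedManyBodySolver.Observables.StiffnessKinematicLeaf
import Literature.MathematicalPhysics.StatisticalMechanics.KosterlitzThoulessStiffnessBound
import HarnessLib

/-!
# Ventures/CertifiedManyBodySolver — Observables/KTTransitionCeiling.lean

HONEST FRAMING: a Kosterlitz–Thouless-type UPPER bound on the transition temperature of the strictly
two-dimensional one-band model from a certified stiffness CEILING; CONDITIONAL on the named KT dictionary
(universal-jump / stability inequality, monotonicity, identification) exactly as printed below; not a `T_c`
estimate, not a superconductivity verdict (a ceiling never speaks to presence), and a MATERIAL ceiling only through a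
separately stated 2D → 3D transfer assumption (ferromagnetic interlayer coupling RAISES ordering temperatures).

Cell `hubbard-tc` (MO-S3 ORDER → `T_c` back-end, D-0096), seat p2, `prover-hubbard-tc-p2-g0-0`; ruling R1 of the cell
referee (VERDICTS.md §1, 2026-08-26): in tree units the KT constant is `π/4`.

**The composition «certified `ρ_s` ceiling ⇒ certified `T_c` upper bound» consuming the hubbard-obs row types.**
The stiffness leaves of `Observables/RungLeaves*.lean` (`ObsStiffnessSeqCeilingAt tp U n c`, `ObsStiffnessCeilingAt`,
`M3ObsStiffnessCeilingAt tp c`, `M3ObsStiffnessCeilingAt_tp0 c`, the named `M3ObsStiffnessCeiling_tp0`) say: every uniform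
flux-stiffness constant `ρ_s` of the `(N_L, S^z = 0)`-sector ground states (`ρ_s θ² ≤ E_L(θ) − E_L(0)` for `|θ| ≤ θ₀`, `θ` the
TOTAL seam flux coupling to the ELECTRON hopping) is `≤ c`. The Kosterlitz–Thouless side is
`Literature.MathematicalPhysics.StatisticalMechanics.KosterlitzThouless` (p1, p456247): for a stiffness profile of the PAIR phase
`J(T) = ρₑ(T)/2` (`phaseStiffnessOfTwistCoeff 2`, charge-2 bookkeeping: the pair phase winds `2θ`), the stability inequality
`StableBelow` plus a ceiling `ρₑ ≤ ρ̄ₑ` on `(0, T_c)` give `T_c ≤ (π/4)·ρ̄ₑ` (`le_pi_div_four_mul_of_pairTwistCeiling`).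
This file supplies the one missing link, the IDENTIFICATION (key K1b / A3 of the cell's ASSUMPTIONS.md): the profile's
ground-state value `ρₑ(0)` is (at most) a uniform flux-stiffness constant of the sector ground states — typed as the predicate
`IsGroundFluxStiffnessSeqAt tp U n ρ₀` («every level `0 < r < ρ₀` satisfies the flux inequality on some window `|θ| ≤ θ₀` along
some sequence of sides `L_j → ∞`», i.e. `ρ₀ ≤ sup_{θ₀} limsup_L inf_{0<|θ|≤θ₀}(E_L(θ)−E_L(0))/θ²`; plain all-even-sides form
`IsGroundFluxStiffnessAt`) — and bundles the dictionary as ONE hypothesis structure `KTDictionaryAt tp U n ρₑ Tc`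
(K2 = `stable`, K3 = `antitone`, K1b = `ground`). PROVED:

* `KTDictionaryAt.le_pi_div_four_mul` — **leaf + dictionary ⇒ `T_c ≤ (π/4)·c`** for the sequence-robust leaf
  `ObsStiffnessSeqCeilingAt tp U n c` at ANY anchor `(U, n, t′)`; `…_of_ceilingAt` for the plain leaf (needs the plain
  identification); `…_m3`, `…_m3_tp0` at `(8, 7/8, t′)` / `(8, 7/8, 0)`;
* rows of record as kernel decimals: `…_of_M3ObsStiffnessCeiling_tp0` — the NAMED leaf (registry row
  `OBS.rhos.tp0.TLchord354x426`, `c = 906213886029816052260099/2⁸¹ ≈ 0.3748013`) gives **`T_c ≤ 0.2943683`** (cell TC-TABLE B1);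
  `…_tpm1o4_row` — the `t′ = −1/4` leaf at `c = 0.36036034…` (row `OBS.rhos.tpm1o4.TLx5w5d2c3b4`) gives **`T_c ≤ 0.2830264`** (B2);
  `…_kinematic` — the UNCONDITIONAL kinematic leaf (`t′ = 0`, every `U`, `0 ≤ n < 2`; `ObsStiffnessSeqCeilingAt_tp0_kinematic`)
  gives **`T_c ≤ 1/π`** for the whole nearest-neighbour family (`(π/4)·(4/π²)`);
* `KTDictionaryAt.ground_pos`, `….ground_le` — under the dictionary `0 < ρₑ(0) ≤ c`.
* §5 (key K4-b made explicit): `KTDictionaryAt.layered_le_mul_pi_div_four_mul` — leaf + dictionary + a stated interlayer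
  transfer `T₃ ≤ E·Tc` (`E ≥ 0`, MODELLING input printed on the row) ⇒ `T₃ ≤ E·(π/4)·c`; at the named leaf `T₃ ≤ E·0.2943683`.
* §6 (weakest jump input): `PairJumpFloorNear ρₑ Tc` — the Nelson–Kosterlitz FLOOR `(2/π)T ≤ ρₑ(T)/2` on SOME window
  `(Tc − η, Tc)` (hypothesis NK₂ of the cell; implied by `StableBelow`) — and `le_pi_div_four_mul_of_pairJumpFloorNear`:
  leaf + NK₂ + monotonicity + identification ⇒ `Tc ≤ (π/4)·c`.

Every theorem is CONDITIONAL on (i) the leaf fed in (itself conditional on its claim nodes when it is a certificate row) and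
(ii) the dictionary structure, whose fields are HYPOTHESES (renormalisation-group inputs and the identification), not theorems
of the Hubbard model; nothing here asserts them. No named fact, zero computation, no `sorry`.

Not here: the thermal (monotonicity-free) chain through the positive-temperature f-sum rule (`QuantumLattice.thermalStiffnessTT'_mul_sq_le_kinetic`)
— p1's thermal leaf plugs into `le_pi_div_four_mul_of_pairTwistCeiling` directly; interlayer / 3D ordering (Literature,
`PlaneRotatorGinibreComparison`); anisotropic stiffness.

References: D. R. Nelson, J. M. Kosterlitz, PRL 39 (1977) 1201 [NelsonKosterlitz1977]; T. Hazra, N. Verma, M. Randeria,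
PRX 9 (2019) 031049, eqs. (2)–(4), App. A, G [HazraVermaRanderia2019]; D. J. Scalapino, S. R. White, S.-C. Zhang, PRB 47 (1993)
7995, §II [ScalapinoWhiteZhang1993].
-/

noncomputable section

namespace Summit.Ventures.CertifiedManyBodySolver.Observables

open Filter Topology Set Real
open Literature.MathematicalPhysics.QuantumLattice
open Literature.MathematicalPhysics.QuantumLattice.ThermodynamicLimit
open Literature.MathematicalPhysics.StatisticalMechanics
open Literature.MathematicalPhysics.StatisticalMechanics.KosterlitzThouless

/-! ## §1 The identification predicates (key K1b / A3) -/

/-- **Identification, sequence-robust form (key K1b).** `ρ₀` is (at most) a uniform flux-stiffness constant of the zero-flux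
`(rectN n L, S^z = 0)`-sector ground states of `hubbardTorusTT' L 1 tp U` in the sequence-robust sense of
`ObsStiffnessSeqCeilingAt`: every level `0 < r < ρ₀` satisfies `r θ² ≤ E_{L_j}(θ) − E_{L_j}(0)` for `|θ| ≤ θ₀` (some `θ₀ > 0`)
along some sequence of sides `L_j → ∞` (`E_L = fluxEnergyTT' L tp U (1 − n)`). This is how the cell reads «the `T = 0` pair
stiffness `J(0) = ρₑ(0)/2` IS the (thermodynamic-limit) flux stiffness the certified leaf bounds» (Hazra–Verma–Randeria `D_s(0)`;
Scalapino–White–Zhang §II). A HYPOTHESIS on the profile, consumed by `KTDictionaryAt.ground`. [cite: ScalapinoWhiteZhang1993, §II] -/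
def IsGroundFluxStiffnessSeqAt (tp U n ρ₀ : ℝ) : Prop :=
  ∀ r : ℝ, 0 < r → r < ρ₀ → ∃ θ₀ : ℝ, 0 < θ₀ ∧ ∃ Ls : ℕ → ℕ, Tendsto Ls atTop atTop ∧
    ∀ (j : ℕ) [NeZero (Ls j)] (θ : ℝ), |θ| ≤ θ₀ →
      r * θ ^ 2 ≤ fluxEnergyTT' (Ls j) tp U (1 - n) θ - fluxEnergyTT' (Ls j) tp U (1 - n) 0

/-- **Identification, plain (all-even-sides) form**: every level `0 < r < ρ₀` satisfies the flux inequality on some window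
`|θ| ≤ θ₀` at EVERY even side `L ≥ L₀` (the hypothesis shape of the plain leaves `ObsStiffnessCeilingAt` /
`M3ObsStiffnessCeilingAt` / `M3ObsStiffnessCeilingAt_tp0`). Implies the sequence-robust form
(`IsGroundFluxStiffnessAt.seq`). [cite: ScalapinoWhiteZhang1993, §II] -/
def IsGroundFluxStiffnessAt (tp U n ρ₀ : ℝ) : Prop :=
  ∀ r : ℝ, 0 < r → r < ρ₀ → ∃ θ₀ : ℝ, 0 < θ₀ ∧ ∃ L₀ : ℕ,
    ∀ (L : ℕ) [NeZero L], L₀ ≤ L → Even L → ∀ θ : ℝ, |θ| ≤ θ₀ →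
      r * θ ^ 2 ≤ fluxEnergyTT' L tp U (1 - n) θ - fluxEnergyTT' L tp U (1 - n) 0

/-- Plain identification ⇒ sequence-robust identification (along the even sides `L_j = 2(L₀ + j + 1)`). -/
theorem IsGroundFluxStiffnessAt.seq {tp U n ρ₀ : ℝ} (h : IsGroundFluxStiffnessAt tp U n ρ₀) :
    IsGroundFluxStiffnessSeqAt tp U n ρ₀ := by
  intro r hr hrρ
  obtain ⟨θ₀, hθ₀, L₀, hst⟩ := h r hr hrρ
  refine ⟨θ₀, hθ₀, fun j => 2 * (L₀ + j + 1),
    tendsto_atTop_mono (fun j : ℕ => (by omega : j ≤ 2 * (L₀ + j + 1))) tendsto_id, ?_⟩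
  intro j _ θ hθ
  exact hst (2 * (L₀ + j + 1)) (by omega) (even_two_mul _) θ hθ

/-- The identification is monotone: a level below an identified one is identified. -/
theorem IsGroundFluxStiffnessSeqAt.mono {tp U n ρ₀ ρ₁ : ℝ} (h : IsGroundFluxStiffnessSeqAt tp U n ρ₀) (hle : ρ₁ ≤ ρ₀) :
    IsGroundFluxStiffnessSeqAt tp U n ρ₁ :=
  fun r hr hrρ => h r hr (hrρ.trans_le hle)

/-- **Leaf + identification ⇒ the identified level is below the ceiling**: if `ρ₀ > 0` is identified in the sequence-robust
sense and the sequence-robust leaf `ObsStiffnessSeqCeilingAt tp U n c` holds, then `ρ₀ ≤ c` (every `r ∈ (0, ρ₀)` is `≤ c`).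
[cite: ScalapinoWhiteZhang1993, §II] -/
theorem IsGroundFluxStiffnessSeqAt.le_of_obsStiffnessSeqCeilingAt {tp U n ρ₀ : ℝ} {c : ℚ}
    (h : IsGroundFluxStiffnessSeqAt tp U n ρ₀) (hρ₀ : 0 < ρ₀) (hleaf : ObsStiffnessSeqCeilingAt tp U n c) :
    ρ₀ ≤ ((c : ℚ) : ℝ) := by
  -- every level `r ∈ (0, ρ₀)` is `≤ c`
  have hr : ∀ r : ℝ, 0 < r → r < ρ₀ → r ≤ ((c : ℚ) : ℝ) := by
    intro r hr0 hrρ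
    obtain ⟨θ₀, hθ₀, Ls, hLs, hst⟩ := h r hr0 hrρ
    exact hleaf r θ₀ hr0 hθ₀ Ls hLs hst
  -- hence `c > 0` and `ρ₀ ≤ c` by density
  have hc : 0 < ((c : ℚ) : ℝ) := lt_of_lt_of_le (half_pos hρ₀) (hr _ (half_pos hρ₀) (half_lt_self hρ₀))
  refine le_of_forall_lt_imp_le_of_dense fun r hrρ => ?_
  rcases le_or_gt r 0 with hr0 | hr0
  · exact hr0.trans hc.le
  · exact hr r hr0 hrρ

/-- The plain-form companion: plain identification + plain leaf `ObsStiffnessCeilingAt tp U n c` ⇒ `ρ₀ ≤ c`.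
[cite: ScalapinoWhiteZhang1993, §II] -/
theorem IsGroundFluxStiffnessAt.le_of_obsStiffnessCeilingAt {tp U n ρ₀ : ℝ} {c : ℚ}
    (h : IsGroundFluxStiffnessAt tp U n ρ₀) (hρ₀ : 0 < ρ₀) (hleaf : ObsStiffnessCeilingAt tp U n c) :
    ρ₀ ≤ ((c : ℚ) : ℝ) := by
  have hr : ∀ r : ℝ, 0 < r → r < ρ₀ → r ≤ ((c : ℚ) : ℝ) := by
    intro r hr0 hrρ
    obtain ⟨θ₀, hθ₀, L₀, hst⟩ := h r hr0 hrρ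
    exact hleaf r θ₀ hr0 hθ₀ L₀ hst
  have hc : 0 < ((c : ℚ) : ℝ) := lt_of_lt_of_le (half_pos hρ₀) (hr _ (half_pos hρ₀) (half_lt_self hρ₀))
  refine le_of_forall_lt_imp_le_of_dense fun r hrρ => ?_
  rcases le_or_gt r 0 with hr0 | hr0
  · exact hr0.trans hc.le
  · exact hr r hr0 hrρ

/-! ## §2 The KT dictionary as one hypothesis structure -/

/-- **The Kosterlitz–Thouless dictionary for the one-band layer at the anchor `(U, n, t′)`** — the cell's keys K2, K3, K1b
bundled for a thermal ELECTRON twist-coefficient profile `ρₑ : ℝ → ℝ` (free-energy cost `ρₑ(T)·θ²` of a total electron seam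
flux `θ`, tree units, `t = 1`, `k_B = 1`; pair-phase stiffness `J(T) = ρₑ(T)/2`) and a candidate transition temperature `Tc`:
* `pos` — `0 < Tc` (there is a transition to speak of);
* `stable` (K2) — the Kosterlitz–Thouless stability inequality `(2/π)·T ≤ J(T)` on `(0, Tc)` for the PAIR stiffness
  `J = phaseStiffnessOfTwistCoeff 2 ρₑ = ρₑ/2` (Nelson–Kosterlitz; a renormalisation-group HYPOTHESIS, see
  `KosterlitzThouless.StableBelow`);
* `antitone` (K3) — `ρₑ` is non-increasing on `[0, Tc)` (Hazra–Verma–Randeria's stated assumption after their eq. (3));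
* `ground` (K1b) — the ground-state value `ρₑ(0)` is identified with a uniform flux-stiffness constant of the sector ground
  states (`IsGroundFluxStiffnessSeqAt`).
Every field is a HYPOTHESIS; a bound proved from the structure is exactly as certified as the leaf fed in and as these
named inputs. [cite: HazraVermaRanderia2019, eqs. (2)–(4) and App. A] -/
structure KTDictionaryAt (tp U n : ℝ) (ρe : ℝ → ℝ) (Tc : ℝ) : Prop where
  /-- `0 < Tc`. -/
  pos : 0 < Tc
  /-- K2: KT stability inequality for the pair stiffness `ρₑ/2` below `Tc`. -/
  stable : StableBelow (fun T => phaseStiffnessOfTwistCoeff 2 (ρe T)) Tc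
  /-- K3: monotonicity of the profile on `[0, Tc)`. -/
  antitone : AntitoneOn ρe (Set.Ico 0 Tc)
  /-- K1b: identification of `ρₑ(0)` with a uniform flux-stiffness constant (sequence-robust form). -/
  ground : IsGroundFluxStiffnessSeqAt tp U n (ρe 0)

namespace KTDictionaryAt

variable {tp U n : ℝ} {ρe : ℝ → ℝ} {Tc : ℝ}

/-- Under the dictionary the ground-state twist coefficient is positive: at `T = Tc/2` stability gives
`0 < (2/π)(Tc/2) ≤ ρₑ(T)/2` and monotonicity gives `ρₑ(T) ≤ ρₑ(0)`. [cite: HazraVermaRanderia2019, eq. (3)] -/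
theorem ground_pos (h : KTDictionaryAt tp U n ρe Tc) : 0 < ρe 0 := by
  have hT : 0 < Tc / 2 := half_pos h.pos
  have hTTc : Tc / 2 < Tc := half_lt_self h.pos
  have h1 : 2 / π * (Tc / 2) ≤ phaseStiffnessOfTwistCoeff 2 (ρe (Tc / 2)) := h.stable hT hTTc
  rw [phaseStiffnessOfTwistCoeff_two] at h1
  have h2 : ρe (Tc / 2) ≤ ρe 0 := h.antitone ⟨le_rfl, h.pos⟩ ⟨hT.le, hTTc⟩ hT.le
  have h3 : 0 < 2 / π * (Tc / 2) := by positivity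
  linarith

/-- Under the dictionary, a sequence-robust leaf bounds the ground-state twist coefficient: `ρₑ(0) ≤ c`.
[cite: ScalapinoWhiteZhang1993, §II] -/
theorem ground_le (h : KTDictionaryAt tp U n ρe Tc) {c : ℚ} (hleaf : ObsStiffnessSeqCeilingAt tp U n c) :
    ρe 0 ≤ ((c : ℚ) : ℝ) :=
  h.ground.le_of_obsStiffnessSeqCeilingAt h.ground_pos hleaf

/-- Under the dictionary, the profile is below `ρₑ(0)` throughout `(0, Tc)`. [cite: HazraVermaRanderia2019, eq. (3)] -/
theorem apply_le_ground (h : KTDictionaryAt tp U n ρe Tc) {T : ℝ} (hT : 0 < T) (hTTc : T < Tc) : ρe T ≤ ρe 0 :=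
  h.antitone ⟨le_rfl, h.pos⟩ ⟨hT.le, hTTc⟩ hT.le

/-! ## §3 Leaf + dictionary ⇒ `T_c ≤ (π/4)·c` -/

/-- **Certified stiffness ceiling ⇒ KT upper bound on `T_c` (sequence-robust leaf, any anchor).** If
`ObsStiffnessSeqCeilingAt tp U n c` holds (a certified row, or the unconditional kinematic leaf) and the profile `ρₑ` with
candidate transition temperature `Tc` satisfies the KT dictionary at `(U, n, t′)`, then `Tc ≤ (π/4)·c` (tree units, `t = 1`):
monotonicity and identification give `ρₑ(T) ≤ ρₑ(0) ≤ c` on `(0, Tc)`, and `le_pi_div_four_mul_of_pairTwistCeiling` (stability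
for the pair stiffness `ρₑ/2`) concludes. The cell's (G1) row grammar «certified-upper·KT (NK jump + monotonicity assumed; 2D
single-layer model)». [cite: HazraVermaRanderia2019, eqs. (2)–(3) and App. G] -/
theorem le_pi_div_four_mul (h : KTDictionaryAt tp U n ρe Tc) {c : ℚ} (hleaf : ObsStiffnessSeqCeilingAt tp U n c) :
    Tc ≤ π / 4 * ((c : ℚ) : ℝ) :=
  le_pi_div_four_mul_of_pairTwistCeiling h.stable h.pos fun _ hT hTTc =>
    (h.apply_le_ground hT hTTc).trans (h.ground_le hleaf)

/-- The same at `(8, 7/8, t′)` from the sequence-robust leaf in M3 form is immediate; this is the PLAIN-LEAF form: if the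
identification holds in the plain (all-even-sides) form, the plain leaf `ObsStiffnessCeilingAt tp U n c` suffices.
[cite: HazraVermaRanderia2019, eqs. (2)–(3)] -/
theorem le_pi_div_four_mul_of_ceilingAt (h : KTDictionaryAt tp U n ρe Tc) (hpl : IsGroundFluxStiffnessAt tp U n (ρe 0))
    {c : ℚ} (hleaf : ObsStiffnessCeilingAt tp U n c) : Tc ≤ π / 4 * ((c : ℚ) : ℝ) :=
  le_pi_div_four_mul_of_pairTwistCeiling h.stable h.pos fun _ hT hTTc =>
    (h.apply_le_ground hT hTTc).trans (hpl.le_of_obsStiffnessCeilingAt h.ground_pos hleaf)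

/-- **At `(8, 7/8, t′)` from the M3 leaf `M3ObsStiffnessCeilingAt tp c`** (the registry's `t′`-generic stiffness leaf shape;
plain identification). [cite: HazraVermaRanderia2019, eqs. (2)–(3)] -/
theorem le_pi_div_four_mul_m3 {tp : ℝ} {ρe : ℝ → ℝ} {Tc : ℝ} (h : KTDictionaryAt tp 8 (7 / 8) ρe Tc)
    (hpl : IsGroundFluxStiffnessAt tp 8 (7 / 8) (ρe 0)) {c : ℚ} (hleaf : M3ObsStiffnessCeilingAt tp c) :
    Tc ≤ π / 4 * ((c : ℚ) : ℝ) :=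
  h.le_pi_div_four_mul_of_ceilingAt hpl ((obsStiffnessCeilingAt_m3_iff tp c).2 hleaf)

/-- **At `(8, 7/8, 0)` from the registry's `t′ = 0` leaf `M3ObsStiffnessCeilingAt_tp0 c`** (plain identification).
[cite: HazraVermaRanderia2019, eqs. (2)–(3)] -/
theorem le_pi_div_four_mul_m3_tp0 {ρe : ℝ → ℝ} {Tc : ℝ} (h : KTDictionaryAt 0 8 (7 / 8) ρe Tc)
    (hpl : IsGroundFluxStiffnessAt 0 8 (7 / 8) (ρe 0)) {c : ℚ} (hleaf : M3ObsStiffnessCeilingAt_tp0 c) :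
    Tc ≤ π / 4 * ((c : ℚ) : ℝ) :=
  h.le_pi_div_four_mul_of_ceilingAt hpl ((obsStiffnessCeilingAt_m3_tp0_iff c).2 hleaf)

/-! ## §4 Rows of record as kernel decimals -/

/-- **TC-TABLE B1 (cell hubbard-tc): the NAMED leaf `M3ObsStiffnessCeiling_tp0`** (`c = 906213886029816052260099/2⁸¹ ≈ 0.3748013`,
registry row `OBS.rhos.tp0.TLchord354x426`, itself CLOSED modulo the claim nodes #354 ∧ #426) **gives `T_c ≤ 0.2943683`** (tree
units, `t = 1`; `(π/4)·c = 0.29436823…`, `π < 3.141593`) for every profile satisfying the KT dictionary at `(8, 7/8, 0)` with plain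
identification. [cite: HazraVermaRanderia2019, eqs. (2)–(3)] -/
theorem le_decimal_of_M3ObsStiffnessCeiling_tp0 {ρe : ℝ → ℝ} {Tc : ℝ} (h : KTDictionaryAt 0 8 (7 / 8) ρe Tc)
    (hpl : IsGroundFluxStiffnessAt 0 8 (7 / 8) (ρe 0)) (hleaf : M3ObsStiffnessCeiling_tp0) :
    Tc ≤ 0.2943683 := by
  have hb := h.le_pi_div_four_mul_m3_tp0 hpl hleaf
  have hπ : π < 3.141593 := Real.pi_lt_d6
  have hc : (((906213886029816052260099 / 2 ^ 81 : ℚ) : ℚ) : ℝ) = 906213886029816052260099 / 2 ^ 81 := by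
    push_cast; ring
  rw [hc] at hb
  nlinarith [hb, hπ]

/-- **TC-TABLE B2: the `t′ = −1/4` leaf at the certified T2-direct edge** `c = 59875132150186218758206329522600765/166153499473114484112975882535043072
≈ 0.3603603` (registry row `OBS.rhos.tpm1o4.TLx5w5d2c3b4`; `M3ObsStiffnessCeilingAt (−1/4) c` is CLOSED modulo its claim nodes in
`Certificates/HubbardSquare_n7o8_obs2_T2direct_tpm1o4_kinx_j248567.lean`) **gives `T_c ≤ 0.2830264`** (`(π/4)·c = 0.28302635…`) for every
profile satisfying the KT dictionary at `(8, 7/8, −1/4)` with plain identification. [cite: HazraVermaRanderia2019, eqs. (2)–(3)] -/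
theorem le_decimal_tpm1o4_row {ρe : ℝ → ℝ} {Tc : ℝ} (h : KTDictionaryAt (-1 / 4) 8 (7 / 8) ρe Tc)
    (hpl : IsGroundFluxStiffnessAt (-1 / 4) 8 (7 / 8) (ρe 0))
    (hleaf : M3ObsStiffnessCeilingAt (-1 / 4)
      (59875132150186218758206329522600765 / 166153499473114484112975882535043072)) :
    Tc ≤ 0.2830264 := by
  have hb := h.le_pi_div_four_mul_m3 hpl hleaf
  have hπ : π < 3.141593 := Real.pi_lt_d6
  have hc : (((59875132150186218758206329522600765 / 166153499473114484112975882535043072 : ℚ) : ℚ) : ℝ) =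
      59875132150186218758206329522600765 / 166153499473114484112975882535043072 := by
    push_cast; ring
  rw [hc] at hb
  nlinarith [hb, hπ]

/-- **The family row (cell TC-TABLE A1): the UNCONDITIONAL kinematic leaf gives `T_c ≤ 1/π`** (`= (π/4)·(4/π²) = 0.3183099…`) at
`t′ = 0` for EVERY coupling `U` and every density `0 ≤ n < 2`, for every profile satisfying the KT dictionary at `(U, n, 0)` —
no certificate, no claim node (`ObsStiffnessSeqCeilingAt_tp0_kinematic`: every rational `c ≥ 4/π²` is a sequence-robust ceiling;
density of `ℚ` in `ℝ` removes the rational rounding). [cite: HazraVermaRanderia2019, App. G] -/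
theorem le_inv_pi_kinematic {U n : ℝ} (hn0 : 0 ≤ n) (hn2 : n < 2) {ρe : ℝ → ℝ} {Tc : ℝ}
    (h : KTDictionaryAt 0 U n ρe Tc) : Tc ≤ 1 / π := by
  have hπ : 0 < π := Real.pi_pos
  -- `Tc ≤ (π/4)·c` for every rational `c ≥ 4/π²`
  have hb : ∀ c : ℚ, 4 / π ^ 2 ≤ ((c : ℚ) : ℝ) → Tc ≤ π / 4 * ((c : ℚ) : ℝ) := fun c hc =>
    h.le_pi_div_four_mul (ObsStiffnessSeqCeilingAt_tp0_kinematic hn0 hn2 c hc)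
  -- density: `(π/4)·(4/π²) = 1/π`
  refine le_of_forall_pos_lt_add fun ε hε => ?_
  have hεπ : 0 < ε / π := by positivity
  obtain ⟨c, hc1, hc2⟩ := exists_rat_btwn (show 4 / π ^ 2 < 4 / π ^ 2 + ε / π by linarith)
  have h1 := hb c hc1.le
  have h2 : π / 4 * ((c : ℚ) : ℝ) < π / 4 * (4 / π ^ 2 + ε / π) := mul_lt_mul_of_pos_left hc2 (by positivity)
  have h3 : π / 4 * (4 / π ^ 2 + ε / π) = 1 / π + ε / 4 := by
    field_simp
  linarith

/-! ## §5 Interlayer transfer made explicit (key K4-b): `T₃ ≤ E·Tc ⇒ T₃ ≤ E·(π/4)·c` -/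

/-- **The layered (K4-b) row form.** If, in addition to the leaf and the dictionary at `(U, n, t′)`, a three-dimensional
ordering temperature `T₃` is tied to the layer's `Tc` by an interlayer-enhancement factor `E ≥ 0`, `T₃ ≤ E·Tc` (the cell's
MODELLING key K4-b: `E = E(Δ)` from layered-XY scaling, hubbard-tc ASSUMPTIONS.md §1 — a hypothesis, printed on every row that
uses it), then `T₃ ≤ E·(π/4)·c`. Pure composition of `le_pi_div_four_mul` with the transfer hypothesis; it lets a phase-map
line cite ONE declaration and list `E` among its non-kernel inputs (mod-1's `InterlayerJumpFloorArithmetic`, wired to the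
leaf). [cite: HazraVermaRanderia2019, eqs. (2)–(3)] -/
theorem layered_le_mul_pi_div_four_mul (h : KTDictionaryAt tp U n ρe Tc) {c : ℚ} (hleaf : ObsStiffnessSeqCeilingAt tp U n c)
    {T₃ E : ℝ} (hE : 0 ≤ E) (h₃ : T₃ ≤ E * Tc) : T₃ ≤ E * (π / 4 * ((c : ℚ) : ℝ)) :=
  h₃.trans (mul_le_mul_of_nonneg_left (h.le_pi_div_four_mul hleaf) hE)

/-- **K4-b at the named leaf (TC-TABLE B1 × E)**: `M3ObsStiffnessCeiling_tp0`, the dictionary at `(8, 7/8, 0)` with plain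
identification and `T₃ ≤ E·Tc`, `E ≥ 0`, give `T₃ ≤ E·0.2943683` (tree units). [cite: HazraVermaRanderia2019, eqs. (2)–(3)] -/
theorem layered_le_mul_decimal_of_M3ObsStiffnessCeiling_tp0 {ρe : ℝ → ℝ} {Tc : ℝ} (h : KTDictionaryAt 0 8 (7 / 8) ρe Tc)
    (hpl : IsGroundFluxStiffnessAt 0 8 (7 / 8) (ρe 0)) (hleaf : M3ObsStiffnessCeiling_tp0) {T₃ E : ℝ} (hE : 0 ≤ E)
    (h₃ : T₃ ≤ E * Tc) : T₃ ≤ E * 0.2943683 :=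
  h₃.trans (mul_le_mul_of_nonneg_left (h.le_decimal_of_M3ObsStiffnessCeiling_tp0 hpl hleaf) hE)

end KTDictionaryAt

/-! ## §6 The weakest jump input: a Nelson–Kosterlitz FLOOR on a window below `Tc` (NK₂) -/

/-- **Nelson–Kosterlitz floor near `Tc⁻` (hypothesis NK₂ of the cell, mod-1 INTERLAYER §2 (U1)(d) / pub-hubbard `bounds.tex`
Hypothesis NK_q with `q = 2`)**: there is a window `(Tc − η, Tc)`, `η > 0`, on which the PAIR stiffness `ρₑ(T)/2` is at least the
universal line `(2/π)·T`. Weaker than `KosterlitzThouless.StableBelow` (the floor on all of `(0, Tc)`) and than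
`KosterlitzThouless.UniversalJumpAt` (the limit EQUALS `(2/π)Tc`); it is what «any jump is at least the universal one» says near the
transition. A HYPOTHESIS (renormalisation-group input). [cite: NelsonKosterlitz1977, eq. (1) (universal jump)] -/
def PairJumpFloorNear (ρe : ℝ → ℝ) (Tc : ℝ) : Prop :=
  ∃ η : ℝ, 0 < η ∧ ∀ ⦃T : ℝ⦄, Tc - η < T → T < Tc → 2 / π * T ≤ phaseStiffnessOfTwistCoeff 2 (ρe T)

/-- `StableBelow` (floor on all of `(0, Tc)`) implies the window floor (any `η`, e.g. `η = Tc`). [cite: NelsonKosterlitz1977, eq. (1)] -/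
theorem PairJumpFloorNear.of_stableBelow {ρe : ℝ → ℝ} {Tc : ℝ} (hTc : 0 < Tc)
    (h : StableBelow (fun T => phaseStiffnessOfTwistCoeff 2 (ρe T)) Tc) : PairJumpFloorNear ρe Tc :=
  ⟨Tc, hTc, fun _ hT hTTc => h (by linarith) hTTc⟩

/-- **Leaf + NK₂ window floor + monotonicity + identification ⇒ `Tc ≤ (π/4)·c`** (the cell's chain (U1) with its weakest jump
input): on the window, `(2/π)T ≤ ρₑ(T)/2 ≤ ρₑ(0)/2 ≤ c/2`, so every `T < Tc` is `≤ (π/4)c`, hence `Tc ≤ (π/4)c`.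
[cite: HazraVermaRanderia2019, eqs. (2)–(3)] -/
theorem le_pi_div_four_mul_of_pairJumpFloorNear {tp U n : ℝ} {c : ℚ} (hleaf : ObsStiffnessSeqCeilingAt tp U n c)
    {ρe : ℝ → ℝ} {Tc : ℝ} (hTc : 0 < Tc) (hfloor : PairJumpFloorNear ρe Tc) (hmono : AntitoneOn ρe (Set.Ico 0 Tc))
    (hId : IsGroundFluxStiffnessSeqAt tp U n (ρe 0)) : Tc ≤ π / 4 * ((c : ℚ) : ℝ) := by
  obtain ⟨η, hη, hwin⟩ := hfloor
  have hπ : 0 < π := Real.pi_pos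
  -- a window `(T₀, Tc)` inside `(0, Tc) ∩ (Tc - η, Tc)`
  set T₀ : ℝ := max (Tc - η) (Tc / 2) with hT₀def
  have hT₀lt : T₀ < Tc := max_lt (by linarith) (by linarith)
  have hT₀pos : 0 < T₀ := lt_of_lt_of_le (by linarith) (le_max_right _ _)
  have hT₀win : Tc - η ≤ T₀ := le_max_left _ _
  -- on the window: `(2/π) T ≤ ρe T / 2 ≤ ρe 0 / 2`
  have hstep : ∀ T : ℝ, T₀ < T → T < Tc → 2 / π * T ≤ ρe 0 / 2 := by
    intro T hT hTTc
    have hT0 : 0 < T := hT₀pos.trans hT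
    have h1 : 2 / π * T ≤ phaseStiffnessOfTwistCoeff 2 (ρe T) := hwin (by linarith) hTTc
    rw [phaseStiffnessOfTwistCoeff_two] at h1
    have h2 : ρe T ≤ ρe 0 := hmono ⟨le_rfl, hTc⟩ ⟨hT0.le, hTTc⟩ hT0.le
    linarith
  -- hence `0 < ρe 0` and `ρe 0 ≤ c`
  have hmid : T₀ < (T₀ + Tc) / 2 := by linarith
  have hmid' : (T₀ + Tc) / 2 < Tc := by linarith
  have hρ0 : 0 < ρe 0 := by
    have h1 := hstep _ hmid hmid'
    have h2 : 0 < 2 / π * ((T₀ + Tc) / 2) := by positivity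
    linarith
  have hρc : ρe 0 ≤ ((c : ℚ) : ℝ) := hId.le_of_obsStiffnessSeqCeilingAt hρ0 hleaf
  -- every `T < Tc` is `≤ (π/4) c`
  refine le_of_forall_lt_imp_le_of_dense fun T hTTc => ?_
  have key : ∀ T : ℝ, T₀ < T → T < Tc → T ≤ π / 4 * ((c : ℚ) : ℝ) := by
    intro T hT hTTc
    have h1 := hstep T hT hTTc
    rw [div_mul_eq_mul_div, div_le_iff₀ hπ] at h1
    nlinarith
  rcases lt_or_ge T₀ T with hT | hT
  · exact key T hT hTTc
  · have h1 := key _ hmid hmid'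
    linarith

end Summit.Ventures.CertifiedManyBodySolver.Observables

end
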